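/-
Copyright: rh-split cell (screw, bridge) gen 19, 2026-08-28.  Splitting search over kernel-typed
RH-equivalences.  A splitting `A ∧ B ⟹ RH` is CONDITIONAL bookkeeping unless `A` and `B` are both
proved; nothing here bears on the truth of RH.
-/
import Summits.RiemannHypothesis.RiemannHypothesis.Theorems.Splittings.SlidingGermA
import Summits.RiemannHypothesis.RiemannHypothesis.Theorems.Splittings.ScrewLatticeWolffA

/-!
# «SLIDING GERM» — part B of 3: mean-value slide bounds and the off-line atom germ

* §3 the SLIDE bound by the mean value theorem inside the ordinate window `[γ/2, 3γ/2]` (`|η| ≤ γ/2`):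
  `|g(γ + η, t) - g(γ, t)| ≤ (9/10)·γt⁴·|η|` if `γt ≤ 2/3` (`abs_slide_le_near`) and `≤ 40t/γ² · |η|`
  for every `t ≥ 0` (`abs_slide_le_far`) — termwise (G2) of rh-splitx-theory-1's `K7-AUDIT.md`.
* §4 the OFF-LINE ATOM germ: for `‖κ‖·|t| ≤ 1`, `κ ≠ 0`, `m ≥ 0` the quadruple term of the tree
  (`ScrewLatticeWolff.quadTerm m κ t = 4m·Re[(cosh κt - 1)/κ²]`) satisfies
  `(43/24)·m·t² ≤ quadTerm m κ t ≤ (53/24)·m·t²` (`quadTerm_germ_bounds`; `Complex.exp_bound` at order 4: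
  `‖cosh z - 1 - z²/2‖ ≤ (5/96)‖z‖⁴`) — «an unresolved atom of weight m looks like ≈ 2m on-line pairs at
  order t²» (termwise (G1); constant `43/24 ≈ 1.79` in place of the memo's `1.82`).

HONEST LABEL: elementary real/complex analysis; an INSTRUMENT for another seat's conjecture; RH-free;
toward RH: 0.  Nothing here bears on the truth of RH.
-/

set_option linter.dupNamespace false

namespace Summit.RiemannHypothesis.RiemannHypothesis.Theorems.Splittings.SlidingGerm

open Summit.RiemannHypothesis.RiemannHypothesis.Theorems.Splittings.ScrewLatticeWolff (quadTerm)

/-! ## 3. Slides: the mean value theorem in an ordinate window -/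

/-- Mean-value bound: if `|∂_γ g(γ', t)| ≤ C` on a window `[a, b] ⊂ (0, ∞)`, then
`|g(γ₂, t) - g(γ₁, t)| ≤ C·|γ₂ - γ₁|` for `γ₁, γ₂` in the window. -/
theorem abs_pairTrace_sub_le_of_bound {a b C t : ℝ} (ha : 0 < a)
    (hC : ∀ γ' ∈ Set.Icc a b, |pairTraceDeriv γ' t| ≤ C) {γ₁ γ₂ : ℝ}
    (h₁ : γ₁ ∈ Set.Icc a b) (h₂ : γ₂ ∈ Set.Icc a b) :
    |pairTrace γ₂ t - pairTrace γ₁ t| ≤ C * |γ₂ - γ₁| := by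
  have hderiv : ∀ γ' ∈ Set.Icc a b,
      HasDerivWithinAt (fun γ ↦ pairTrace γ t) (pairTraceDeriv γ' t) (Set.Icc a b) γ' :=
    fun γ' hγ' ↦ (hasDerivAt_pairTrace (ne_of_gt (lt_of_lt_of_le ha hγ'.1)) t).hasDerivWithinAt
  have hbound : ∀ γ' ∈ Set.Icc a b, ‖pairTraceDeriv γ' t‖ ≤ C :=
    fun γ' h ↦ by rw [Real.norm_eq_abs]; exact hC γ' h
  have := Convex.norm_image_sub_le_of_norm_hasDerivWithin_le hderiv hbound (convex_Icc a b) h₁ h₂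
  simpa only [Real.norm_eq_abs] using this

/-- Window membership: `γ ∈ [γ/2, 3γ/2]`. -/
theorem self_mem_window {γ : ℝ} (hγ : 0 < γ) : γ ∈ Set.Icc (γ / 2) (3 * γ / 2) :=
  ⟨by linarith, by linarith⟩

/-- Window membership: `γ + η ∈ [γ/2, 3γ/2]` when `|η| ≤ γ/2`. -/
theorem add_mem_window {γ η : ℝ} (hη : |η| ≤ γ / 2) : γ + η ∈ Set.Icc (γ / 2) (3 * γ / 2) := by
  obtain ⟨h1, h2⟩ := abs_le.mp hη
  exact ⟨by linarith, by linarith⟩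

/-- NEAR SLIDE (`γt ≤ 2/3`, `|η| ≤ γ/2`): `|g(γ + η, t) - g(γ, t)| ≤ (9/10)·γ·t⁴·|η|` — order `t⁴`, not `t²`. -/
theorem abs_slide_le_near {γ η t : ℝ} (hγ : 0 < γ) (hη : |η| ≤ γ / 2) (ht : 0 ≤ t)
    (h : γ * t ≤ 2 / 3) :
    |pairTrace (γ + η) t - pairTrace γ t| ≤ 9 / 10 * γ * t ^ 4 * |η| := by
  have hC : ∀ γ' ∈ Set.Icc (γ / 2) (3 * γ / 2), |pairTraceDeriv γ' t| ≤ 9 / 10 * γ * t ^ 4 := by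
    intro γ' hγ'
    have hγ'0 : 0 < γ' := by linarith [hγ'.1]
    have hγ't : γ' * t ≤ 1 := by nlinarith [hγ'.2]
    calc |pairTraceDeriv γ' t| ≤ 3 / 5 * γ' * t ^ 4 := abs_pairTraceDeriv_le_near hγ'0 ht hγ't
      _ ≤ 3 / 5 * (3 * γ / 2) * t ^ 4 := by gcongr; exact hγ'.2
      _ = 9 / 10 * γ * t ^ 4 := by ring
  have := abs_pairTrace_sub_le_of_bound (by positivity : 0 < γ / 2) hC (self_mem_window hγ)
    (add_mem_window hη)
  simpa [add_sub_cancel_left] using this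

/-- FAR SLIDE (`|η| ≤ γ/2`, any `t ≥ 0`; the useful regime is `γt ≥ 2/3`):
`|g(γ + η, t) - g(γ, t)| ≤ 40t/γ² · |η|`. -/
theorem abs_slide_le_far {γ η t : ℝ} (hγ : 0 < γ) (hη : |η| ≤ γ / 2) (ht : 0 ≤ t) :
    |pairTrace (γ + η) t - pairTrace γ t| ≤ 40 * t / γ ^ 2 * |η| := by
  have hC : ∀ γ' ∈ Set.Icc (γ / 2) (3 * γ / 2), |pairTraceDeriv γ' t| ≤ 40 * t / γ ^ 2 := by
    intro γ' hγ'
    have hγ'0 : 0 < γ' := by linarith [hγ'.1]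
    have hsq : γ ^ 2 ≤ 4 * γ' ^ 2 := by nlinarith [hγ'.1]
    rcases le_or_gt 1 (γ' * t) with hfar | hnear
    · calc |pairTraceDeriv γ' t| ≤ 10 * t / γ' ^ 2 := abs_pairTraceDeriv_le_far hγ'0 ht hfar
        _ ≤ 40 * t / γ ^ 2 := by
          rw [div_le_div_iff₀ (by positivity) (by positivity)]
          nlinarith [hsq, ht]
    · -- `γ't < 1`: crude bound `4t²/γ' ≤ 4t/γ'² ≤ 16t/γ²`
      calc |pairTraceDeriv γ' t| ≤ 4 * t ^ 2 / γ' := abs_pairTraceDeriv_le_crude hγ'0 ht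
        _ ≤ 40 * t / γ ^ 2 := by
          rw [div_le_div_iff₀ hγ'0 (by positivity)]
          have h1 : t * γ' ≤ 1 := by linarith [hnear, mul_comm γ' t]
          have : 4 * t ^ 2 * γ ^ 2 ≤ 16 * t * (t * γ') * γ' := by nlinarith [hsq, ht, sq_nonneg t]
          calc 4 * t ^ 2 * γ ^ 2 ≤ 16 * t * (t * γ') * γ' := this
            _ ≤ 16 * t * 1 * γ' := by gcongr
            _ ≤ 40 * t * γ' := by nlinarith [ht, hγ'0.le]
  have := abs_pairTrace_sub_le_of_bound (by positivity : 0 < γ / 2) hC (self_mem_window hγ)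
    (add_mem_window hη)
  simpa [add_sub_cancel_left] using this

/-! ## 4. Off-line atoms: the `t²`-germ of the quadruple term -/

/-- Order-4 remainder of `cosh`: `‖cosh z - 1 - z²/2‖ ≤ (5/96)‖z‖⁴` for `‖z‖ ≤ 1` (two applications of
`Complex.exp_bound`). -/
theorem norm_cosh_sub_one_sub_sq_le {z : ℂ} (hz : ‖z‖ ≤ 1) :
    ‖Complex.cosh z - 1 - z ^ 2 / 2‖ ≤ 5 / 96 * ‖z‖ ^ 4 := by
  have hP : ∀ w : ℂ, ∑ m ∈ Finset.range 4, w ^ m / (m.factorial : ℂ) = 1 + w + w ^ 2 / 2 + w ^ 3 / 6 := by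
    intro w
    simp [Finset.sum_range_succ, Nat.factorial]
  have hnum : ((Nat.succ 4 : ℕ) : ℝ) * (((Nat.factorial 4 : ℕ) : ℝ) * ((4 : ℕ) : ℝ))⁻¹ = 5 / 96 := by
    norm_num [Nat.factorial]
  have h1 : ‖Complex.exp z - (1 + z + z ^ 2 / 2 + z ^ 3 / 6)‖ ≤ ‖z‖ ^ 4 * (5 / 96) := by
    have h := Complex.exp_bound hz (show 0 < 4 by norm_num)
    rw [hP, hnum] at h
    exact h
  have hz' : ‖-z‖ ≤ 1 := by rwa [norm_neg]
  have h2 : ‖Complex.exp (-z) - (1 + -z + (-z) ^ 2 / 2 + (-z) ^ 3 / 6)‖ ≤ ‖z‖ ^ 4 * (5 / 96) := by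
    have h := Complex.exp_bound hz' (show 0 < 4 by norm_num)
    rw [hP, hnum, norm_neg] at h
    exact h
  have hcosh : Complex.cosh z - 1 - z ^ 2 / 2 =
      ((Complex.exp z - (1 + z + z ^ 2 / 2 + z ^ 3 / 6)) +
        (Complex.exp (-z) - (1 + -z + (-z) ^ 2 / 2 + (-z) ^ 3 / 6))) / 2 := by
    have := Complex.two_cosh z
    linear_combination (1 / 2 : ℂ) * this
  rw [hcosh, norm_div, RCLike.norm_ofNat, div_le_iff₀ (by norm_num : (0 : ℝ) < 2)]
  calc ‖(Complex.exp z - (1 + z + z ^ 2 / 2 + z ^ 3 / 6)) +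
        (Complex.exp (-z) - (1 + -z + (-z) ^ 2 / 2 + (-z) ^ 3 / 6))‖
      ≤ ‖Complex.exp z - (1 + z + z ^ 2 / 2 + z ^ 3 / 6)‖ +
        ‖Complex.exp (-z) - (1 + -z + (-z) ^ 2 / 2 + (-z) ^ 3 / 6)‖ := norm_add_le _ _
    _ ≤ ‖z‖ ^ 4 * (5 / 96) + ‖z‖ ^ 4 * (5 / 96) := add_le_add h1 h2
    _ = 5 / 96 * ‖z‖ ^ 4 * 2 := by ring

/-- The real part of `(cosh κt - 1)/κ²` splits as `t²/2 + Re[(cosh z - 1 - z²/2)/κ²]`, `z = κt`, `κ ≠ 0`. -/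
theorem cosh_div_re_eq {κ : ℂ} (hκ : κ ≠ 0) (t : ℝ) :
    ((Complex.cosh (κ * t) - 1) / κ ^ 2).re =
      t ^ 2 / 2 + ((Complex.cosh (κ * t) - 1 - (κ * t) ^ 2 / 2) / κ ^ 2).re := by
  have hsplit : (Complex.cosh (κ * t) - 1) / κ ^ 2 =
      (t : ℂ) ^ 2 / 2 + (Complex.cosh (κ * t) - 1 - (κ * t) ^ 2 / 2) / κ ^ 2 := by
    field_simp
    ring
  have hre : ((t : ℂ) ^ 2 / 2).re = t ^ 2 / 2 := by
    have : (t : ℂ) ^ 2 / 2 = ((t ^ 2 / 2 : ℝ) : ℂ) := by push_cast; ring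
    rw [this, Complex.ofReal_re]
  rw [hsplit, Complex.add_re, hre]

/-- The germ error: `|Re[(cosh κt - 1)/κ²] - t²/2| ≤ (5/96)·t²` for `‖κ‖·|t| ≤ 1`, `κ ≠ 0`. -/
theorem abs_cosh_div_re_sub_le {κ : ℂ} (hκ : κ ≠ 0) {t : ℝ} (h : ‖κ‖ * |t| ≤ 1) :
    |((Complex.cosh (κ * t) - 1) / κ ^ 2).re - t ^ 2 / 2| ≤ 5 / 96 * t ^ 2 := by
  rw [cosh_div_re_eq hκ t, add_sub_cancel_left, ← sq_abs t]
  have hz : ‖κ * (t : ℂ)‖ = ‖κ‖ * |t| := by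
    rw [norm_mul, Complex.norm_real, Real.norm_eq_abs]
  have hz1 : ‖κ * (t : ℂ)‖ ≤ 1 := by rw [hz]; exact h
  have hκpos : 0 < ‖κ‖ := norm_pos_iff.mpr hκ
  have hst : (‖κ‖ * |t|) ^ 2 ≤ 1 := pow_le_one₀ (by positivity) h
  calc |((Complex.cosh (κ * t) - 1 - (κ * t) ^ 2 / 2) / κ ^ 2).re|
      ≤ ‖(Complex.cosh (κ * t) - 1 - (κ * t) ^ 2 / 2) / κ ^ 2‖ := Complex.abs_re_le_norm _
    _ = ‖Complex.cosh (κ * t) - 1 - (κ * t) ^ 2 / 2‖ / ‖κ‖ ^ 2 := by rw [norm_div, norm_pow]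
    _ ≤ 5 / 96 * ‖κ * (t : ℂ)‖ ^ 4 / ‖κ‖ ^ 2 := by
        gcongr
        exact norm_cosh_sub_one_sub_sq_le hz1
    _ = 5 / 96 * |t| ^ 2 * (‖κ‖ * |t|) ^ 2 := by
        rw [hz]
        field_simp
    _ ≤ 5 / 96 * |t| ^ 2 * 1 := by gcongr
    _ = 5 / 96 * |t| ^ 2 := by ring

/-- **OFF-LINE ATOM GERM.**  For an unresolved atom (`‖κ‖·|t| ≤ 1`, `κ ≠ 0`, weight `m ≥ 0`):
`(43/24)·m·t² ≤ quadTerm m κ t ≤ (53/24)·m·t²` — at order `t²` an atom of weight `m` contributes like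
`≈ 2m` on-line pairs (`43/24 ≈ 1.79`, `53/24 ≈ 2.21`). -/
theorem quadTerm_germ_bounds {m : ℝ} {κ : ℂ} {t : ℝ} (hm : 0 ≤ m) (hκ : κ ≠ 0) (h : ‖κ‖ * |t| ≤ 1) :
    43 / 24 * m * t ^ 2 ≤ quadTerm m κ t ∧ quadTerm m κ t ≤ 53 / 24 * m * t ^ 2 := by
  have hb := abs_le.mp (abs_cosh_div_re_sub_le hκ h)
  unfold quadTerm
  constructor
  · nlinarith [hb.1]
  · nlinarith [hb.2]

end Summit.RiemannHypothesis.RiemannHypothesis.Theorems.Splittings.SlidingGerm
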